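import Summits.QuantumFields.BalabanUV.T4Continuum.Support.VectorGaugeCovarianceEnd
import Summits.QuantumFields.BalabanUV.T4Continuum.Support.VariationalColourTaxiTowerProjGRegular

/-!
# T⁴ programme, spine node NE2 (U1a), lane P2 — «V-GAUGE-COV», file 5: THE CAPSTONE IN ORBIT FORM — EXISTENCE of the vector tower limit at Bałaban's taxi data for
# Bałaban's COVARIANT projected gauge functional ⇐ (ONE-min) + «the tower is regular IN SOME COHERENT LATTICE GAUGE» (model level, `E = ℂ`; cell `pub-balaban`)

NE2 formalisation swarm `b2b-balaban-t4-ne2-formalise-*`, leaf prover 03 GEN 7 (`prover-b2b-balaban-t4-ne2-formalise-leaf-03-g7-0`); register row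
«P2-sup» of `t4/formal/NE2/LEAVES.md`; journal INTENT «V-GAUGE-COV» CLAIMS.log l.19543.  Composition BY NAME of files 1–4 (`VectorGaugeCovariance*`) with leaf-04-g6's
part 7 `VariationalColourTaxiTowerProjGRegular.effV_tendsto_taxiTower_projG_regular_of_class` (p232805) — the capstone whose one remaining presentation-dependent hypothesis
(«`‖Rlev k − 1‖ ≤ a_k`, `‖Rlev k(x,μ) − Rlev k(x−e_μ,μ)‖ ≤ ℓ_k` for the PRESENTED level bonds») is here replaced by the ORBIT statement «… for the level bonds IN THE GAUGE
`ulev u′ k`», `u′` any COHERENT family of unitary site fields.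
 * §1 gauge families along the taxi tower: `ulev u′ k` (the level-`k` site field; one DATA `def`), the coherence condition `u′ (k+1) (base points) = u′ k ∘ sites`, and THE
   TOWER LAWS: `Rlev (R′^{u′}) k = (Rlev R′ k)^{ulev k}`, `nestLv (R′^{u′}) k = gaugeL v (ulev k) (nestLv R′ k)` (`v` = `ulev 0` at the unit-lattice base points),
   `taxiTv (Rlev (R′^{u′}) k) = gaugeF (·) (ulev k) (taxiTv (Rlev R′ k))`; the gauged one-step tower is unitary, in the SAME plaquette class, and coherent;
 * §2 `GmProj (R^u) (K^u) = U·GmProj R K·Uᴴ` (forms agree by `projG_gauge`; `eq_of_forms_eq`);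
 * §3 **`effV_tendsto_taxiTower_projG_of_gaugeRegular`**: part 7's conclusion for the PRESENTED tower `R′` from part 7's hypotheses with the regular presentation asked only
   of the GAUGED level bonds `(Rlev R′ k)^{ulev u′ k}` (and (ONE-min)_k for the presented data) — part 7 applied to `R′^{u′}`, read back through file 4's
   `effV_limit_of_gauge` and §1–§2.
READING.  With this file the existence half of the vector END at Bałaban's taxi data displays: the one-step data classes (unitary, `(L^{k+1})²b_k ≤ c`, coherent), the
numerics, (ONE-min)_k, and «∃ a coherent lattice gauge in which the level bonds are `(α, λ)`-regular» — a statement about the ORBIT of the data; the EXISTENCE of such a gauge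
for small-curvature data is [Balaban1985RegularGauge] territory (node NE3) and is NOT claimed.

HONEST FRAMING (T4-DAG p. 1).  Model level (c5), `E = ℂ`; [folklore] bookkeeping over tree theorems imported BY NAME, NO analytic content; one data `def` (`ulev`), no
`def … : Prop`, no `sorry`; axioms standard.  V-END with background NOT proved ((ONE-min) displayed); NE2 NOT proved on either road; NE3 OPEN; spine PROVED 0∕9 unchanged;
rung (B)+1 on a fixed finite T⁴ — NOT infinite volume, NOT mass gap, NOT Clay.  HONEST DEPENDENCY (cell, verbatim): continuum YM on T⁴ ⇐ BetaPertH ∧ nine spine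
estimates (0/9 proved); BetaPertH ⇐ (D1) ∧ (D4) ∧ CAP+tail; G-an2-4 gates asym, D1 and NE2/3/4.
-/

noncomputable section

namespace Summit.QuantumFields.BalabanUV.T4Continuum.VectorGaugeCovariance

open Finset Matrix Filter
open scoped BigOperators Matrix ComplexConjugate ComplexOrder Topology
open Literature.MathematicalPhysics.QuantumFieldTheory.Balaban1983to89.B5Prop11Plancherel (Tor fine unitVec Cst)
open Literature.MathematicalPhysics.QuantumFieldTheory.Balaban1983to89.B5Block118 (tstep tstep_zero bpt)
open Literature.MathematicalPhysics.QuantumFieldTheory.Balaban1983to89.B5Composition116 (sites)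
open Literature.Analysis.Complex (qform qform_conj)
open Summit.QuantumFields.BalabanUV.T4Continuum.VariationalTransfer (blockSpin)
open Summit.QuantumFields.BalabanUV.T4Continuum.VariationalColourTower (Rtrv)
open Summit.QuantumFields.BalabanUV.T4Continuum.VariationalCovariantTower (sites_add)
open Summit.QuantumFields.BalabanUV.T4Continuum.VariationalTower (sites_unitVec)
open Summit.QuantumFields.BalabanUV.T4Continuum.VariationalColourTaxiTransport
  (taxiTv coarseTv Rlev nestLv Rlev_mem_unitary effV_tendsto_taxiTower_projG_regular_of_class)
open Summit.QuantumFields.BalabanUV.T4Continuum.VectorBlockTrialForm (nsqV QvL compL)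
open Summit.QuantumFields.BalabanUV.T4Continuum.VariationalVectorFederbush (lineT)
open Summit.QuantumFields.BalabanUV.T4Continuum.VariationalVectorForm (ScV SfV qWV)
open Summit.QuantumFields.BalabanUV.T4Continuum.VariationalVectorOneStepPhys (rhoV)
open Summit.QuantumFields.BalabanUV.T4Continuum.VariationalVectorEffective (unc cur unc_cur cur_unc effV)
open Summit.QuantumFields.BalabanUV.T4Continuum.VariationalEffectiveOperator (eq_of_forms_eq)
open Summit.QuantumFields.BalabanUV.T4Continuum.VariationalVectorTower (QmL)
open Summit.QuantumFields.BalabanUV.T4Continuum.VariationalVectorGaugeSlice (avgOp projG)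
open Summit.QuantumFields.BalabanUV.T4Continuum.VariationalVectorRegularityCovariant (GmProj GmProj_posSemidef projG_eq_qform)
open Summit.QuantumFields.BalabanUV.T4Continuum.SliceComplementFlatGap (deltaGap)

variable {d : ℕ}

/-! ## §1 Coherent gauge families along the taxi tower and the tower laws -/

section Tower

variable (L : ℕ) [NeZero L] (M : Fin d → ℕ) [hM : ∀ μ, NeZero (M μ)]

/-- **the level-`k` site field** of a family `u′ k` of site fields on the one-step fine tori `Tor (fine L (fine (L^k) M))` (level `k+1` over level `k`): at level `0` the
restriction of `u′ 0` to the base points, at level `k+1` the field `u′ k` read on the composite torus through `sites`. [folklore] -/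
def ulev (u' : (k : ℕ) → Tor (fine L (fine (L ^ k) M)) → (ℂ →L[ℂ] ℂ)) : (k : ℕ) → Tor (fine (L ^ k) M) → (ℂ →L[ℂ] ℂ)
  | 0 => fun y => u' 0 (bpt L (fine (L ^ 0) M) y 0)
  | k + 1 => fun x => u' k (sites (L ^ k) L M x)

variable {R' : (k : ℕ) → Tor (fine L (fine (L ^ k) M)) → Fin d → (ℂ →L[ℂ] ℂ)}
variable {u' : (k : ℕ) → Tor (fine L (fine (L ^ k) M)) → (ℂ →L[ℂ] ℂ)} (hu' : ∀ k x, u' k x ∈ unitary (ℂ →L[ℂ] ℂ))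
variable (hucoh : ∀ k (y : Tor (fine (L ^ (k + 1)) M)), u' (k + 1) (bpt L (fine (L ^ (k + 1)) M) y 0) = u' k (sites (L ^ k) L M y))

include hu' in
omit hM in
/-- the level fields are unitary. [folklore] -/
theorem ulev_mem_unitary : ∀ (k : ℕ) (x : Tor (fine (L ^ k) M)), ulev L M u' k x ∈ unitary (ℂ →L[ℂ] ℂ)
  | 0, _ => hu' 0 _
  | _ + 1, _ => hu' _ _

include hucoh in
omit hM in
/-- coherence read on the level fields: `u′ k` at the base points IS `ulev k`. [folklore] -/
theorem u'_bpt_eq_ulev : ∀ (k : ℕ) (y : Tor (fine (L ^ k) M)), u' k (bpt L (fine (L ^ k) M) y 0) = ulev L M u' k y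
  | 0, _ => rfl
  | k + 1, y => hucoh k y

include hucoh in
omit hM in
/-- the same as a function. [folklore] -/
theorem u'_bpt_eq_ulev' (k : ℕ) : (fun y => u' k (bpt L (fine (L ^ k) M) y 0)) = ulev L M u' k := funext (u'_bpt_eq_ulev L M hucoh k)

include hu' in
omit hM in
/-- **TOWER LAW FOR THE LEVEL BONDS**: `Rlev (R′^{u′}) k = (Rlev R′ k)^{ulev k}`. [folklore] -/
theorem Rlev_gauge : ∀ k : ℕ, Rlev L M (fun k => gaugeR (fine L (fine (L ^ k) M)) (u' k) (R' k)) k = gaugeR (fine (L ^ k) M) (ulev L M u' k) (Rlev L M R' k)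
  | 0 => by funext y μ; exact coarseTv_gauge L (fine (L ^ 0) M) (hu' 0) (R' 0) y μ
  | k + 1 => by
    show Rtrv (L ^ k) L M (gaugeR _ (u' k) (R' k)) = gaugeR _ (ulev L M u' (k + 1)) (Rtrv (L ^ k) L M (R' k))
    rw [Rtrv_gauge]; rfl

include hu' hucoh in
/-- **TOWER LAW FOR THE ONE-STEP CARRIERS**: `lineT (taxiTv (R′^{u′} k)) (R′^{u′} k) = gaugeL (ulev k) (u′ k) (lineT (taxiTv (R′ k)) (R′ k))`. [folklore] -/
theorem lineT_tower_gauge (k : ℕ) : lineT L (fine (L ^ k) M) (taxiTv L (fine (L ^ k) M) (gaugeR _ (u' k) (R' k))) (gaugeR _ (u' k) (R' k))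
    = gaugeL L (fine (L ^ k) M) (ulev L M u' k) (u' k) (lineT L (fine (L ^ k) M) (taxiTv L (fine (L ^ k) M) (R' k)) (R' k)) := by
  rw [taxiTv_gauge_eq_gaugeF L (fine (L ^ k) M) (hu' k), u'_bpt_eq_ulev' L M hucoh k, lineT_gauge L (fine (L ^ k) M) (hu' k)]

include hu' hucoh in
/-- **TOWER LAW FOR THE CARRIERS**: `nestLv (R′^{u′}) k = gaugeL v (ulev k) (nestLv R′ k)` with the unit-lattice field `v y = ulev 0 (bpt (L^0) M y 0)`. [folklore] -/
theorem nestLv_gauge : ∀ k : ℕ, nestLv L M (fun k => gaugeR (fine L (fine (L ^ k) M)) (u' k) (R' k)) k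
      = gaugeL (L ^ k) M (fun y => ulev L M u' 0 (bpt (L ^ 0) M y 0)) (ulev L M u' k) (nestLv L M R' k)
  | 0 => by
    funext y j t ν
    have hj : j = fun _ => 0 := funext fun i => Fin.ext (by
      have h := (j i).is_lt; simp only [pow_zero] at h; simp only [Fin.val_zero]; omega)
    have ht : (t : ℕ) = 0 := by have h := t.is_lt; simp only [pow_zero] at h; omega
    subst hj
    show (1 : ℂ →L[ℂ] ℂ) = ulev L M u' 0 (bpt (L ^ 0) M y 0) * 1 * star (ulev L M u' 0 (bpt (L ^ 0) M y (fun _ => 0) + tstep (fine (L ^ 0) M) ν (t : ℕ)))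
    rw [ht, tstep_zero, add_zero, mul_one]
    exact (mul_star_self (ulev_mem_unitary L M hu' 0) _).symm
  | k + 1 => by
    show compL (L ^ k) L M (nestLv L M (fun k => gaugeR (fine L (fine (L ^ k) M)) (u' k) (R' k)) k)
        (lineT L (fine (L ^ k) M) (taxiTv L (fine (L ^ k) M) (gaugeR _ (u' k) (R' k))) (gaugeR _ (u' k) (R' k))) = _
    rw [nestLv_gauge k, lineT_tower_gauge L M hu' hucoh k, compL_gauge (L ^ k) L M (ulev_mem_unitary L M hu' k)]
    rfl

include hu' in
/-- **TOWER LAW FOR THE STRAIGHT TAXI FRAMES**: `taxiTv (Rlev (R′^{u′}) k) = gaugeF (y ↦ ulev k (bpt y 0)) (ulev k) (taxiTv (Rlev R′ k))`. [folklore] -/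
theorem taxiTv_Rlev_gauge (k : ℕ) : taxiTv (L ^ k) M (Rlev L M (fun k => gaugeR (fine L (fine (L ^ k) M)) (u' k) (R' k)) k)
    = gaugeF (L ^ k) M (fun y => ulev L M u' k (bpt (L ^ k) M y 0)) (ulev L M u' k) (taxiTv (L ^ k) M (Rlev L M R' k)) := by
  rw [Rlev_gauge L M hu', taxiTv_gauge_eq_gaugeF (L ^ k) M (ulev_mem_unitary L M hu' k)]

include hu' in
omit [NeZero L] hM in
/-- the gauged one-step tower is unitary. [folklore] -/
theorem gaugeTower_mem_unitary (hU : ∀ k x μ, R' k x μ ∈ unitary (ℂ →L[ℂ] ℂ)) (k : ℕ) (x : Tor (fine L (fine (L ^ k) M))) (μ : Fin d) :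
    gaugeR (fine L (fine (L ^ k) M)) (u' k) (R' k) x μ ∈ unitary (ℂ →L[ℂ] ℂ) := gaugeR_mem_unitary (hu' k) (hU k) x μ

include hu' in
omit [NeZero L] hM in
/-- **the plaquette defect is GAUGE-INVARIANT** (it is conjugated by `u x`, `u (x + e_κ + e_ι)`). [folklore] -/
theorem norm_plaq_gauge (k : ℕ) (x : Tor (fine L (fine (L ^ k) M))) (κ ι : Fin d) :
    ‖gaugeR _ (u' k) (R' k) x κ * gaugeR _ (u' k) (R' k) (x + unitVec _ κ) ι - gaugeR _ (u' k) (R' k) x ι * gaugeR _ (u' k) (R' k) (x + unitVec _ ι) κ‖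
      = ‖R' k x κ * R' k (x + unitVec _ κ) ι - R' k x ι * R' k (x + unitVec _ ι) κ‖ := by
  have e : gaugeR _ (u' k) (R' k) x κ * gaugeR _ (u' k) (R' k) (x + unitVec _ κ) ι - gaugeR _ (u' k) (R' k) x ι * gaugeR _ (u' k) (R' k) (x + unitVec _ ι) κ
      = u' k x * (R' k x κ * R' k (x + unitVec _ κ) ι - R' k x ι * R' k (x + unitVec _ ι) κ) * star (u' k (x + unitVec _ κ + unitVec _ ι)) := by
    rw [mul_sub, sub_mul]
    simp only [gaugeR, mul_assoc, add_right_comm x (unitVec (fine L (fine (L ^ k) M)) ι) (unitVec _ κ)]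
    rw [← mul_assoc (star (u' k (x + unitVec _ κ))) (u' k (x + unitVec _ κ)), star_mul_self (hu' k), one_mul,
      ← mul_assoc (star (u' k (x + unitVec _ ι))) (u' k (x + unitVec _ ι)), star_mul_self (hu' k), one_mul]
  rw [e]
  -- `‖w A w′⋆‖ = ‖A‖` for unitary `w`, `w′`
  have hle : ∀ (w w' A : ℂ →L[ℂ] ℂ), w ∈ unitary (ℂ →L[ℂ] ℂ) → w' ∈ unitary (ℂ →L[ℂ] ℂ) → ‖w * A * star w'‖ ≤ ‖A‖ := fun w w' A hw hw' => by
    have h1 : ‖w‖ ≤ 1 := VariationalColourFederbush.norm_le_one_of_mem_unitary hw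
    have h2 : ‖star w'‖ ≤ 1 := VariationalColourFederbush.norm_le_one_of_mem_unitary (Unitary.star_mem hw')
    calc ‖w * A * star w'‖ ≤ ‖w * A‖ * ‖star w'‖ := norm_mul_le _ _
      _ ≤ (‖w‖ * ‖A‖) * ‖star w'‖ := mul_le_mul_of_nonneg_right (norm_mul_le _ _) (norm_nonneg _)
      _ ≤ (1 * ‖A‖) * 1 := by gcongr
      _ = ‖A‖ := by ring
  refine le_antisymm (hle _ _ _ (hu' k _) (hu' k _)) ?_
  have h := hle (star (u' k x)) (star (u' k (x + unitVec _ κ + unitVec _ ι)))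
    (u' k x * (R' k x κ * R' k (x + unitVec _ κ) ι - R' k x ι * R' k (x + unitVec _ ι) κ) * star (u' k (x + unitVec _ κ + unitVec _ ι)))
    (Unitary.star_mem (hu' k _)) (Unitary.star_mem (hu' k _))
  have e2 : star (u' k x) * (u' k x * (R' k x κ * R' k (x + unitVec _ κ) ι - R' k x ι * R' k (x + unitVec _ ι) κ)
      * star (u' k (x + unitVec _ κ + unitVec _ ι))) * star (star (u' k (x + unitVec _ κ + unitVec _ ι)))
      = R' k x κ * R' k (x + unitVec _ κ) ι - R' k x ι * R' k (x + unitVec _ ι) κ := by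
    rw [star_star, ← mul_assoc, ← mul_assoc, star_mul_self (hu' k), one_mul, mul_assoc, star_mul_self (hu' k), mul_one]
  rw [e2] at h
  exact h

include hu' hucoh in
omit hM in
/-- **the gauged one-step tower is COHERENT** when the data are coherent and the site fields are coherent. [folklore] -/
theorem gaugeTower_coherent (hcoh : ∀ k, coarseTv L (fine (L ^ (k + 1)) M) (R' (k + 1)) = Rtrv (L ^ k) L M (R' k)) (k : ℕ) :
    coarseTv L (fine (L ^ (k + 1)) M) (gaugeR _ (u' (k + 1)) (R' (k + 1))) = Rtrv (L ^ k) L M (gaugeR _ (u' k) (R' k)) := by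
  funext y μ
  rw [coarseTv_gauge L (fine (L ^ (k + 1)) M) (hu' (k + 1)), hcoh k, Rtrv_gauge]
  simp only [gaugeR, hucoh k]
  erw [sites_add, sites_unitVec]

end Tower

/-! ## §2 The slice kernel, the matrix of the projected functional and the functional along the tower -/

section Proj

variable (n : ℕ) [NeZero n] (M : Fin d → ℕ) [hM : ∀ μ, NeZero (M μ)]
variable {u : Tor (fine n M) → (ℂ →L[ℂ] ℂ)} (hu : ∀ x, u x ∈ unitary (ℂ →L[ℂ] ℂ))
include hu

/-- **`GmProj (R^u) (K.map (mulS u)) = U · GmProj R K · Uᴴ`** (both PSD; their forms are `projG`, invariant by `projG_gauge`). [folklore] -/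
theorem GmProj_gauge (R : Tor (fine n M) → Fin d → (ℂ →L[ℂ] ℂ)) (K : Submodule ℂ (Tor (fine n M) → ℂ)) :
    GmProj (fine n M) (gaugeR (fine n M) u R) (K.map (mulS (fine n M) u)) = phaseM (fine n M) u * GmProj (fine n M) R K * (phaseM (fine n M) u)ᴴ := by
  refine eq_of_forms_eq (GmProj_posSemidef _ _ _).1 (isHermitian_mul_mul_conjTranspose _ (GmProj_posSemidef _ R K).1) fun w => ?_
  show qform (GmProj (fine n M) (gaugeR (fine n M) u R) (K.map (mulS (fine n M) u))) w = qform (phaseM (fine n M) u * GmProj (fine n M) R K * (phaseM (fine n M) u)ᴴ) w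
  rw [← unc_cur w, qform_conj_unc n M hu, ← projG_eq_qform, ← projG_eq_qform, ← projG_gauge hu R K (gaugeW (fine n M) (fun x => star (u x)) (cur w)),
    gaugeW_gaugeW_star hu]

end Proj

section TowerProj

variable (L : ℕ) [NeZero L] (M : Fin d → ℕ) [hM : ∀ μ, NeZero (M μ)]
variable {R' : (k : ℕ) → Tor (fine L (fine (L ^ k) M)) → Fin d → (ℂ →L[ℂ] ℂ)}
variable {u' : (k : ℕ) → Tor (fine L (fine (L ^ k) M)) → (ℂ →L[ℂ] ℂ)} (hu' : ∀ k x, u' k x ∈ unitary (ℂ →L[ℂ] ℂ))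
include hu'

/-- **TOWER LAW FOR THE SLICE KERNEL**: `ker Q_{taxiTv (Rlev (R′^{u′}) k)} = (ker Q_{taxiTv (Rlev R′ k)}).map (mulS (ulev k))`. [folklore] -/
theorem ker_tower_gauge (k : ℕ) :
    LinearMap.ker (avgOp (L ^ k) M (taxiTv (L ^ k) M (Rlev L M (fun k => gaugeR (fine L (fine (L ^ k) M)) (u' k) (R' k)) k)))
      = (LinearMap.ker (avgOp (L ^ k) M (taxiTv (L ^ k) M (Rlev L M R' k)))).map (mulS (fine (L ^ k) M) (ulev L M u' k)) := by
  rw [taxiTv_Rlev_gauge L M hu' k,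
    ker_avgOp_gauge (L ^ k) M (ulev_mem_unitary L M hu' k) (fun y => ulev_mem_unitary L M hu' k (bpt (L ^ k) M y 0))]

/-- **TOWER LAW FOR THE MATRIX**: `GmProj (Rlev (R′^{u′}) k) (ker^) = U_k · GmProj (Rlev R′ k) (ker) · U_kᴴ`. [folklore] -/
theorem GmProj_tower_gauge (k : ℕ) :
    GmProj (fine (L ^ k) M) (Rlev L M (fun k => gaugeR (fine L (fine (L ^ k) M)) (u' k) (R' k)) k)
        (LinearMap.ker (avgOp (L ^ k) M (taxiTv (L ^ k) M (Rlev L M (fun k => gaugeR (fine L (fine (L ^ k) M)) (u' k) (R' k)) k))))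
      = phaseM (fine (L ^ k) M) (ulev L M u' k)
          * GmProj (fine (L ^ k) M) (Rlev L M R' k) (LinearMap.ker (avgOp (L ^ k) M (taxiTv (L ^ k) M (Rlev L M R' k))))
          * (phaseM (fine (L ^ k) M) (ulev L M u' k))ᴴ := by
  rw [ker_tower_gauge L M hu' k, Rlev_gauge L M hu' k, GmProj_gauge (L ^ k) M (ulev_mem_unitary L M hu' k)]

/-- **TOWER LAW FOR THE FUNCTIONAL**: `projG (Rlev (R′^{u′}) k) (ker^) (W^{ulev k}) = projG (Rlev R′ k) (ker) W`. [folklore] -/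
theorem projG_tower_gauge (k : ℕ) (W : Tor (fine (L ^ k) M) → Fin d → ℂ) :
    projG (fine (L ^ k) M) (Rlev L M (fun k => gaugeR (fine L (fine (L ^ k) M)) (u' k) (R' k)) k)
        (LinearMap.ker (avgOp (L ^ k) M (taxiTv (L ^ k) M (Rlev L M (fun k => gaugeR (fine L (fine (L ^ k) M)) (u' k) (R' k)) k))))
        (gaugeW (fine (L ^ k) M) (ulev L M u' k) W)
      = projG (fine (L ^ k) M) (Rlev L M R' k) (LinearMap.ker (avgOp (L ^ k) M (taxiTv (L ^ k) M (Rlev L M R' k)))) W := by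
  rw [ker_tower_gauge L M hu' k, Rlev_gauge L M hu' k, projG_gauge (ulev_mem_unitary L M hu' k)]

end TowerProj

/-! ## §3 The capstone in orbit form -/

section Orbit

variable (L : ℕ) [NeZero L] (M : Fin d → ℕ) [hM : ∀ μ, NeZero (M μ)]
variable {R' : (k : ℕ) → Tor (fine L (fine (L ^ k) M)) → Fin d → (ℂ →L[ℂ] ℂ)}

/-- **EXISTENCE OF THE VECTOR TOWER LIMIT AT BAŁABAN's TAXI DATA FOR BAŁABAN's COVARIANT PROJECTED GAUGE FUNCTIONAL — ORBIT FORM.**  Part 7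
(`effV_tendsto_taxiTower_projG_regular_of_class`, p232805) verbatim, except that the regular presentation (`‖· − 1‖ ≤ a_k`, lattice-Lipschitz `ℓ_k`, `L^k a_k ≤ α`,
`(L^k)² ℓ_k ≤ λ`) is asked of the level bonds IN A COHERENT LATTICE GAUGE `ulev u′ k` (any unitary site fields `u′ k` on the one-step tori with
`u′ (k+1) (base points) = u′ k ∘ sites`), not of the presented ones; (ONE-min)_k is displayed for the PRESENTED data; the conclusion is for the PRESENTED tower.
PROOF: part 7 for the gauged tower `R′^{u′}` (unitary, same plaquette class, coherent — §1; its (ONE-min) by file 4's `hONEm_gauge`), read back through file 4's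
`effV_limit_of_gauge` and the tower laws. [folklore] -/
theorem effV_tendsto_taxiTower_projG_of_gaugeRegular (hL : 2 ≤ L) (hd : 1 ≤ d) (hM2 : ∀ μ, 1 < M μ)
    -- the one-step bond data: unitary, plaquette class, coherent
    (hU : ∀ k x μ, R' k x μ ∈ unitary (ℂ →L[ℂ] ℂ)) {b : ℕ → ℝ} {c : ℝ}
    (hb : ∀ k x κ ι, ‖R' k x κ * R' k (x + unitVec (fine L (fine (L ^ k) M)) κ) ι - R' k x ι * R' k (x + unitVec (fine L (fine (L ^ k) M)) ι) κ‖ ≤ b k)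
    (hbc : ∀ k, (((L ^ (k + 1) : ℕ)) : ℝ) ^ 2 * b k ≤ c)
    (hcoh : ∀ k, coarseTv L (fine (L ^ (k + 1)) M) (R' (k + 1)) = Rtrv (L ^ k) L M (R' k))
    (hsm1 : 60 * (6 : ℝ) ^ (d - 1) * ((2 * ((((d - 1 : ℕ) : ℝ) + (d : ℝ) * d)) + 3 * ((d - 1 : ℕ) : ℝ)) * c) ≤ 1 / 2)
    (hsm2 : 2 * (d : ℝ) * ((((d - 1 : ℕ) : ℝ)) * c) ^ 2 ≤ 1 / 2) (hsm3 : 64 * (2 * ((((d - 1 : ℕ) : ℝ) + (d : ℝ) * d) * c)) ^ 2 ≤ 1)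
    (hsm4 : 80 * ((d : ℝ) * c) ≤ 1)
    -- the COHERENT LATTICE GAUGE and the regular presentation IN THAT GAUGE
    {u' : (k : ℕ) → Tor (fine L (fine (L ^ k) M)) → (ℂ →L[ℂ] ℂ)} (hu' : ∀ k x, u' k x ∈ unitary (ℂ →L[ℂ] ℂ))
    (hucoh : ∀ k (y : Tor (fine (L ^ (k + 1)) M)), u' (k + 1) (bpt L (fine (L ^ (k + 1)) M) y 0) = u' k (sites (L ^ k) L M y))
    {ar ℓr : ℕ → ℝ} {α lam : ℝ} (har0 : ∀ k, 0 ≤ ar k)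
    (har : ∀ k x μ, ‖gaugeR (fine (L ^ k) M) (ulev L M u' k) (Rlev L M R' k) x μ - 1‖ ≤ ar k)
    (hℓr : ∀ k x μ, ‖gaugeR (fine (L ^ k) M) (ulev L M u' k) (Rlev L M R' k) x μ
      - gaugeR (fine (L ^ k) M) (ulev L M u' k) (Rlev L M R' k) (x - unitVec (fine (L ^ k) M) μ) μ‖ ≤ ℓr k)
    (hα : ∀ k, (((L ^ k : ℕ)) : ℝ) * ar k ≤ α) (hlam : ∀ k, (((L ^ k : ℕ)) : ℝ) ^ 2 * ℓr k ≤ lam)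
    (hsmallδ : (18 * (d * ((d + 1 : ℝ) * Cst d 1)) + 6) * deltaGap d 1 α lam (d * α) (((d - 1 : ℕ) : ℝ) * c) ^ 2 ≤ 1 / 2)
    (hsmallQ : ((d + 1 : ℝ) * Cst d 1) * (7 * (d * α ^ 2) + 2 * (2 * ((((d - 1 : ℕ) : ℝ) + (d : ℝ) * d) * c) + (d * α + α)) ^ 2) ≤ 1 / 2)
    -- the effective-operator parameter, the decay rate and the DISPLAYED leaf (ONE-min) for the PRESENTED data
    {aa : ℝ} (haa : 0 < aa) {θ : ℝ} (hθ : 0 ≤ θ) (hθ1 : θ < 1)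
    (ε₁ δ' : ℕ → ℝ) {cε cδ' : ℝ} (hε₁ : ∀ k, 0 ≤ ε₁ k) (hδ' : ∀ k, 0 ≤ δ' k) (hεθ : ∀ k, ε₁ k ≤ cε * θ ^ k) (hδ'θ : ∀ k, δ' k ≤ cδ' * θ ^ k)
    (hONEm : ∀ k (φ : Tor M → Fin d → ℂ) (W₀ : Tor (fine (L ^ k) M) → Fin d → ℂ), QvL (L ^ k) M (nestLv L M R' k) W₀ = φ →
      (∀ W, QvL (L ^ k) M (nestLv L M R' k) W = φ →
        ScV (L ^ k) M (Rlev L M R' k) (projG (fine (L ^ k) M) (Rlev L M R' k) (LinearMap.ker (avgOp (L ^ k) M (taxiTv (L ^ k) M (Rlev L M R' k))))) W₀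
          ≤ ScV (L ^ k) M (Rlev L M R' k) (projG (fine (L ^ k) M) (Rlev L M R' k) (LinearMap.ker (avgOp (L ^ k) M (taxiTv (L ^ k) M (Rlev L M R' k))))) W) →
      ∃ g, QvL (L ^ k) M (nestLv L M R' k) (QvL L (fine (L ^ k) M) (lineT L (fine (L ^ k) M) (taxiTv L (fine (L ^ k) M) (R' k)) (R' k)) g) = φ ∧
        SfV (L ^ k) L M (R' k)
            (fun W' => projG (fine (L ^ (k + 1)) M) (Rlev L M R' (k + 1)) (LinearMap.ker (avgOp (L ^ (k + 1)) M (taxiTv (L ^ (k + 1)) M (Rlev L M R' (k + 1)))))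
              (W' ∘ sites (L ^ k) L M)) g
          ≤ (Real.sqrt (ScV (L ^ k) M (Rlev L M R' k) (projG (fine (L ^ k) M) (Rlev L M R' k) (LinearMap.ker (avgOp (L ^ k) M (taxiTv (L ^ k) M (Rlev L M R' k))))) W₀
                + ε₁ k * rhoV (L ^ k) M (Rlev L M R' k) W₀)
              + δ' k * Real.sqrt (qWV (L ^ k) M W₀)) ^ 2) :
    ∃ Xlim : Matrix (Tor M × Fin d) (Tor M × Fin d) ℂ,
      Tendsto (fun k => effV (L ^ k) M (Rlev L M R' k)
        (GmProj (fine (L ^ k) M) (Rlev L M R' k) (LinearMap.ker (avgOp (L ^ k) M (taxiTv (L ^ k) M (Rlev L M R' k))))) (QmL (L ^ k) M (nestLv L M R' k)) aa)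
        atTop (𝓝 Xlim) ∧ Xlim.IsHermitian ∧ (∀ v, 0 ≤ qform Xlim v) ∧
      ∀ φ : Tor M → Fin d → ℂ, Tendsto (fun k => blockSpin (QvL (L ^ k) M (nestLv L M R' k))
        (ScV (L ^ k) M (Rlev L M R' k) (projG (fine (L ^ k) M) (Rlev L M R' k) (LinearMap.ker (avgOp (L ^ k) M (taxiTv (L ^ k) M (Rlev L M R' k)))))) φ)
        atTop (𝓝 (qform Xlim (unc φ))) := by
  -- the unit-lattice rotation and the level fields
  have hv : ∀ y : Tor M, (fun y => ulev L M u' 0 (bpt (L ^ 0) M y 0)) y ∈ unitary (ℂ →L[ℂ] ℂ) := fun y => ulev_mem_unitary L M hu' 0 _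
  have hug : ∀ k x, ulev L M u' k x ∈ unitary (ℂ →L[ℂ] ℂ) := ulev_mem_unitary L M hu'
  -- part 7 for the gauged tower
  -- part 7 for the gauged one-step tower `k ↦ (R′ k)^{u′ k}`
  have h7 := effV_tendsto_taxiTower_projG_regular_of_class L M (R' := fun k => gaugeR (fine L (fine (L ^ k) M)) (u' k) (R' k)) hL
    (gaugeTower_mem_unitary L M hu' hU)
    (fun k x κ ι => by rw [norm_plaq_gauge L M hu']; exact hb k x κ ι) hbc (gaugeTower_coherent L M hu' hucoh hcoh) hd hM2 hsm1 hsm2 hsm3 hsm4 har0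
    (fun k x μ => by rw [Rlev_gauge L M hu' k]; exact har k x μ) (fun k x μ => by rw [Rlev_gauge L M hu' k]; exact hℓr k x μ) hα hlam hsmallδ hsmallQ
    haa hθ hθ1 ε₁ δ' hε₁ hδ' hεθ hδ'θ
    (fun k φ W₀ hW₀ hmin => by
      rw [nestLv_gauge L M hu' hucoh k] at hW₀
      rw [ker_tower_gauge L M hu' k, Rlev_gauge L M hu' k, nestLv_gauge L M hu' hucoh k] at hmin
      rw [ker_tower_gauge L M hu' k, ker_tower_gauge L M hu' (k + 1), Rlev_gauge L M hu' k, Rlev_gauge L M hu' (k + 1), nestLv_gauge L M hu' hucoh k,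
        lineT_tower_gauge L M hu' hucoh k]
      refine hONEm_gauge (L ^ k) L M hv (hug k) (hu' k)
        (G := projG (fine (L ^ k) M) (Rlev L M R' k) (LinearMap.ker (avgOp (L ^ k) M (taxiTv (L ^ k) M (Rlev L M R' k)))))
        (Gu := projG (fine (L ^ k) M) (gaugeR _ (ulev L M u' k) (Rlev L M R' k))
          ((LinearMap.ker (avgOp (L ^ k) M (taxiTv (L ^ k) M (Rlev L M R' k)))).map (mulS _ (ulev L M u' k))))
        (fun W => projG_gauge (hug k) _ _ W)
        (G' := fun W' => projG (fine (L ^ (k + 1)) M) (Rlev L M R' (k + 1)) (LinearMap.ker (avgOp (L ^ (k + 1)) M (taxiTv (L ^ (k + 1)) M (Rlev L M R' (k + 1)))))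
          (W' ∘ sites (L ^ k) L M))
        (Gu' := fun W' => projG (fine (L ^ (k + 1)) M) (gaugeR _ (ulev L M u' (k + 1)) (Rlev L M R' (k + 1)))
          ((LinearMap.ker (avgOp (L ^ (k + 1)) M (taxiTv (L ^ (k + 1)) M (Rlev L M R' (k + 1))))).map (mulS _ (ulev L M u' (k + 1)))) (W' ∘ sites (L ^ k) L M))
        (fun W' => ?_) (hONEm k) φ W₀ hW₀ hmin
      exact projG_gauge (hug (k + 1)) _ _ (W' ∘ sites (L ^ k) L M))
  -- read back through the orbit transfer
  obtain ⟨X, hT, hH, hnn, hform⟩ := h7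
  refine effV_limit_of_gauge L M hv hug (fun k => Rlev L M R' k)
    (fun k => GmProj (fine (L ^ k) M) (Rlev L M R' k) (LinearMap.ker (avgOp (L ^ k) M (taxiTv (L ^ k) M (Rlev L M R' k)))))
    (fun k => projG (fine (L ^ k) M) (Rlev L M R' k) (LinearMap.ker (avgOp (L ^ k) M (taxiTv (L ^ k) M (Rlev L M R' k)))))
    (fun k => projG (fine (L ^ k) M) (gaugeR _ (ulev L M u' k) (Rlev L M R' k))
      ((LinearMap.ker (avgOp (L ^ k) M (taxiTv (L ^ k) M (Rlev L M R' k)))).map (mulS _ (ulev L M u' k))))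
    (nestLv L M R') (fun k W => projG_gauge (hug k) _ _ W) ⟨X, ?_, hH, hnn, fun φ => ?_⟩
  · have e : (fun k => effV (L ^ k) M (gaugeR (fine (L ^ k) M) (ulev L M u' k) (Rlev L M R' k))
        (phaseM (fine (L ^ k) M) (ulev L M u' k) * GmProj (fine (L ^ k) M) (Rlev L M R' k) (LinearMap.ker (avgOp (L ^ k) M (taxiTv (L ^ k) M (Rlev L M R' k))))
          * (phaseM (fine (L ^ k) M) (ulev L M u' k))ᴴ)
        (QmL (L ^ k) M (gaugeL (L ^ k) M (fun y => ulev L M u' 0 (bpt (L ^ 0) M y 0)) (ulev L M u' k) (nestLv L M R' k))) aa)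
        = fun k => effV (L ^ k) M (Rlev L M (fun k => gaugeR (fine L (fine (L ^ k) M)) (u' k) (R' k)) k) (GmProj (fine (L ^ k) M) (Rlev L M (fun k => gaugeR (fine L (fine (L ^ k) M)) (u' k) (R' k)) k) (LinearMap.ker (avgOp (L ^ k) M (taxiTv (L ^ k) M (Rlev L M (fun k => gaugeR (fine L (fine (L ^ k) M)) (u' k) (R' k)) k)))))
            (QmL (L ^ k) M (nestLv L M (fun k => gaugeR (fine L (fine (L ^ k) M)) (u' k) (R' k)) k)) aa := funext fun k => by
      rw [GmProj_tower_gauge L M hu' k, Rlev_gauge L M hu' k, nestLv_gauge L M hu' hucoh k]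
    rw [e]; exact hT
  · have e : (fun k => blockSpin (QvL (L ^ k) M (gaugeL (L ^ k) M (fun y => ulev L M u' 0 (bpt (L ^ 0) M y 0)) (ulev L M u' k) (nestLv L M R' k)))
        (ScV (L ^ k) M (gaugeR (fine (L ^ k) M) (ulev L M u' k) (Rlev L M R' k))
          (projG (fine (L ^ k) M) (gaugeR _ (ulev L M u' k) (Rlev L M R' k))
            ((LinearMap.ker (avgOp (L ^ k) M (taxiTv (L ^ k) M (Rlev L M R' k)))).map (mulS _ (ulev L M u' k))))) φ)
        = fun k => blockSpin (QvL (L ^ k) M (nestLv L M (fun k => gaugeR (fine L (fine (L ^ k) M)) (u' k) (R' k)) k))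
            (ScV (L ^ k) M (Rlev L M (fun k => gaugeR (fine L (fine (L ^ k) M)) (u' k) (R' k)) k) (projG (fine (L ^ k) M) (Rlev L M (fun k => gaugeR (fine L (fine (L ^ k) M)) (u' k) (R' k)) k) (LinearMap.ker (avgOp (L ^ k) M (taxiTv (L ^ k) M (Rlev L M (fun k => gaugeR (fine L (fine (L ^ k) M)) (u' k) (R' k)) k)))))) φ :=
      funext fun k => by rw [ker_tower_gauge L M hu' k, Rlev_gauge L M hu' k, nestLv_gauge L M hu' hucoh k]
    rw [e]; exact hform φ

end Orbit

end Summit.QuantumFields.BalabanUV.T4Continuum.VectorGaugeCovariance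

end
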